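import Summits.ResolutionOfSingularities.ResolutionOfSingularities.Theorems.EquisingularLiftEquisingularLiftNatNodalEmbeddedCurveLiftDefs
import HarnessLib

/-!
# [OURS · L1 W4.5(b) · EL♮(3) · WIDTH TABLE D8 «NODAL HOSTED ROUND (HR-KEEP-N)», support debt S-D8-LIFT, part 4 (A)] THE DOOR-REGIME NODAL LIFT RESIDUE
# `NodalCurveLiftAt` / `NodalCurveLift O k θ P q` / `NodalCurveLiftFact` — ✓ `NodalEmbeddedCurveLiftAt` (p694677) with the two DIMENSION binders
# (D1) «`dim 𝒪_{Z̃,z} = 1`» and (D2) «`dim 𝒪_{Ẽ,i z} = 2`» at the closed points of `Z̃`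

res-L1-w45b-stub-4 g14 (desk R69 (iii) / DESK WORD g25-19; split of record STATUS 2026-08-29T04:20:51Z).  OURS; planning vocabulary of the crux chain,
NOT a statement of any manuscript ([Hironaka2017] is a candidate under adjudication, D-0012/D-0089, nothing of it is asserted here); AI-written, weaker
than expert review.  Definitions + pure-logic lemmas only (no `sorry`, standard axioms).  `--supports stmt-ResolutionOfSingularities-20148 --as helper`.

WHY (res-L1-w45b-crit-3 g9's by-type caveat, STATUS l.≈85447, and this seat's part-4 line l.≈85441).  The all-dimension nodal residue
`NodalEmbeddedCurveLiftAt` quantifies, like F-88's `EmbeddedCurveLiftAt`, over exceptional «surfaces» `V(𝓔)` of ANY relative dimension; but for a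
NON-regular `Z̃` the lift route (J1 `EmbeddedInfinitesimalLiftFact` ✓ + F-88 `GrothendieckExistence` + a first-order twist by the (N4) section) needs
`Z̃ ⊆ Ẽ` to be an effective CARTIER divisor at the non-regular points (there `𝓘/𝓘² ⊗ k(z) = k·f`, `f ∈ 𝔪²`, and «regular total space» ⟺ «the
`ϖ`-coefficient of the lifted equation is a unit» ⟺ (N4)); in codimension `≥ 2` inside `Ẽ` the typed (N4) is too weak (crit-3: `Z̃ = V(uv, w)`, `m = w`).
The DOOR's regime — `Z` a curve on the exceptional SURFACE trace of the 3-fold special fibre — is pinned here by two binders in the `hZdim` currency of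
the chain: (D1) `dim 𝒪_{Z̃,z} = 1` and (D2) `dim 𝒪_{Ẽ,i z} = 2` at every closed point `z` of `Z̃` (then the radical ideal of `Z̃` in the regular, hence
factorial, `𝒪_{Ẽ,i z}` has all its minimal primes of height one and is principal).  Both are DERIVED in the hosted round (part 4 (B),
`nodalHostedRoundFact_of_nodalCurveLiftFact`): (D1) is `NodalHostedRoundFact`'s own `hZdim`, (D2) is T-DIM (✓ `ringKrullDim_stalk_eq_succ_of_chain`:
`dim 𝒪_{X′,x} = 4`) + the letter's principal non-zero stalk (`dim 𝒪_{V(𝓔),x} = 3`) + stub-3's flat dimension formula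
(✓ `ringKrullDim_quotient_stalkIdeal_eq_of_model`: `dim 𝒪_{V(𝓔),x} = dim 𝒪_{Ẽ,z} + 1`).

WHAT.
* `NodalCurveLiftAt O k θ X σ q 𝓔` — ✓ `NodalEmbeddedCurveLiftAt` VERBATIM with (D1) and (D2) INSERTED right after (N1); conclusion unchanged.
* `NodalCurveLift O k θ P q`, `NodalCurveLiftFact` — the same closures.
* PURE LOGIC: `nodalCurveLiftAt_of_nodalEmbeddedCurveLiftAt`, `nodalCurveLift_of_nodalEmbeddedCurveLift`, `nodalCurveLiftFact_of_nodalEmbeddedCurveLiftFact`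
  (the all-dimension residue implies the door-regime one: two idle binders).
The DISCHARGE `nodalCurveLiftFact_of_grothendieckExistence : GrothendieckExistence → NodalCurveLiftFact` is part 4 (C) (stub-4 g14 with res-L1-w45b-nose-w1 g5
as second pen, split of record STATUS 2026-08-29T04:20:51Z); consumed ONLY as a hypothesis until then.
References (index only): R. Hartshorne, *Deformation Theory*, GTM 257 (2010), Thm. 6.2, Thm. 22.3; EGA III₁ 5.1.4/5.4.5; H. Matsumura, *Commutative
Ring Theory* (1986), Thm. 20.3 (tree ✓ `Matsumura1987_20_3_holds`).
-/

set_option linter.dupNamespace false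

noncomputable section

open CategoryTheory AlgebraicGeometry TopologicalSpace
open Literature.AlgebraicGeometry.Resolution
open AlgebraicGeometry.Scheme.IdealSheafData

namespace Summit.ResolutionOfSingularities.ResolutionOfSingularities.Cruxes.EquisingularLiftNat.Sections

/-! ### The door-regime nodal residue (T-k)-N₂ -/

/-- **`NodalCurveLiftAt O k θ X σ q 𝓔` — the DOOR-REGIME nodal residue (T-k)-N₂ at ONE exceptional surface**: ✓ `NodalEmbeddedCurveLiftAt` (F-88's
`EmbeddedCurveLiftAt` with «`Z̃` regular» ↦ (N1) finite non-regular locus + (N4) a normal section that is a unit there) with, right after (N1), the two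
dimension binders (D1) «`ringKrullDim 𝒪_{Z̃,z} = 1` at every closed `z`» (the chain's `hZdim`) and (D2) «`ringKrullDim 𝒪_{Ẽ,i z} = 2` at every closed
`z`, for the inclusion `i : Z̃ ⟶ Ẽ`» — `Z` a reduced CURVE on the regular SURFACE trace `Ẽ`, so that `Z̃ ⊆ Ẽ` is an effective Cartier divisor;
conclusion UNCHANGED (a centre `C ⊇ 𝓔`, regular, `O`-flat, exact reduced trace `C·𝒪_G = 𝓘⟨Z⟩`, quasi-regular 2-frames where `V(C)` has codimension 2).
[OURS · L1 W4.5b · residue (T-k)-N₂] (Hartshorne 2010, Thm. 6.2/22.3; Kollár 1996, Thm. I.2.10 — index only); consumed ONLY as a hypothesis; NOT a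
statement of the manuscript. -/
def NodalCurveLiftAt (O : Type) [CommRing O] (k : Type) [Field k] (θ : O →+* k) {P : Scheme.{0}}
    (X : Scheme.{0}) (σ : X ⟶ P) (q : P ⟶ Spec (.of O)) (𝓔 : X.IdealSheafData) : Prop :=
  IsIntegral X → IsLocallyNoetherian X → Scheme.IsRegular X →
  Scheme.IsRegular 𝓔.subscheme → Flat (𝓔.subschemeι ≫ σ ≫ q) → IsProper (𝓔.subschemeι ≫ σ ≫ q) →
  ∀ (G : Scheme.{0}) (j : G ⟶ X) (t : G ⟶ Spec (.of k)),
    IsPullback j t (σ ≫ q) (Spec.map (CommRingCat.ofHom θ)) →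
    ∀ (E : Set G) (hE : IsClosed E), 𝓔.comap j = vanishingIdeal (⟨E, hE⟩ : Closeds G) →
    ∀ (Z : Set G) (hZ : IsClosed Z), Z ⊆ E →
      Set.Finite {x : ↥(redSub G Z hZ) | ¬ IsRegularLocalRing ((redSub G Z hZ).presheaf.stalk x)} →
      (∀ z : ↥(redSub G Z hZ), IsClosed ({z} : Set ↥(redSub G Z hZ)) → ringKrullDim ((redSub G Z hZ).presheaf.stalk z) = ((1 : ℕ) : WithBot ℕ∞)) →
      (∀ (i : redSub G Z hZ ⟶ redSub G E hE), i ≫ redSubι G E hE = redSubι G Z hZ →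
        ∀ z : ↥(redSub G Z hZ), IsClosed ({z} : Set ↥(redSub G Z hZ)) → ringKrullDim ((redSub G E hE).presheaf.stalk (i z)) = ((2 : ℕ) : WithBot ℕ∞)) →
      (∀ (i : redSub G Z hZ ⟶ redSub G E hE), i ≫ redSubι G E hE = redSubι G Z hZ →
        ∀ x : redSub G Z hZ, IsRegularLocalRing ((redSub G E hE).presheaf.stalk (i x))) →
      DirStepUnobs G E hE Z hZ →
      (∀ (i : redSub G Z hZ ⟶ redSub G E hE), i ≫ redSubι G E hE = redSubι G Z hZ →
        ∃ ψ : Γ(Literature.AlgebraicGeometry.HodgeTheory.normalSheaf i, ⊤),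
          ∀ z : ↥(redSub G Z hZ), IsClosed ({z} : Set ↥(redSub G Z hZ)) → ¬ IsRegularLocalRing ((redSub G Z hZ).presheaf.stalk z) →
            ∃ (U : (redSub G E hE).affineOpens) (hz : z ∈ i ⁻¹ᵁ (U : (redSub G E hE).Opens))
              (m : Γ(Literature.AlgebraicGeometry.Deformation.idealModule i, (U : (redSub G E hE).Opens))),
              IsUnit ((redSub G Z hZ).presheaf.germ (i ⁻¹ᵁ (U : (redSub G E hE).Opens)) z hz
                (Literature.AlgebraicGeometry.HodgeTheory.normalSectionsVal i U
                  (Literature.AlgebraicGeometry.HodgeTheory.normalSheafSectionsEquiv i _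
                    ((Literature.AlgebraicGeometry.HodgeTheory.normalSheaf i).presheaf.map (homOfLE le_top).op ψ)) m))) →
      ∃ C : X.IdealSheafData, 𝓔 ≤ C ∧ Scheme.IsRegular C.subscheme ∧ Flat (C.subschemeι ≫ σ ≫ q) ∧
        C.comap j = vanishingIdeal (⟨Z, hZ⟩ : Closeds G) ∧
        ∀ x ∈ C.support, ringKrullDim (X.presheaf.stalk x ⧸ stalkIdeal C x) + 2 = ringKrullDim (X.presheaf.stalk x) →
          ∃ c : Fin 2 → X.presheaf.stalk x, Ideal.span (Set.range c) = stalkIdeal C x ∧ IsQuasiRegular c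

/-- **`NodalCurveLift O k θ P q`** — (T-k)-N₂ for the WHOLE tower over `q : P ⟶ Spec O`: `NodalCurveLiftAt` at every stage and every exceptional
surface. [OURS · L1 W4.5b · residue (T-k)-N₂]; hypothesis-only; NOT a statement of the manuscript. -/
def NodalCurveLift (O : Type) [CommRing O] (k : Type) [Field k] (θ : O →+* k) (P : Scheme.{0}) (q : P ⟶ Spec (.of O)) : Prop :=
  ∀ (X : Scheme.{0}) (σ : X ⟶ P) (𝓔 : X.IdealSheafData), NodalCurveLiftAt O k θ X σ q 𝓔

/-- **`NodalCurveLiftFact`** — (T-k)-N₂ closed over every base the chain may choose (F-88's closure: every algebraically closed `k`, every adically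
complete DVR `O` with a surjection `θ : O → k`, every `P` over `Spec O`).  [OURS · L1 W4.5b · residue (T-k)-N₂]; hypothesis-only; NOT a statement of
the manuscript; its discharge modulo F-88 `GrothendieckExistence` is part 4 (C). -/
def NodalCurveLiftFact : Prop :=
  ∀ (k : Type) [Field k] [IsAlgClosed k] (O : Type) [CommRing O] [IsDomain O] [IsDiscreteValuationRing O]
    [IsAdicComplete (IsLocalRing.maximalIdeal O) O] (θ : O →+* k), Function.Surjective θ →
    ∀ (P : Scheme.{0}) (q : P ⟶ Spec (.of O)), NodalCurveLift O k θ P q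

/-! ### Pure logic: the all-dimension residue implies the door-regime one -/

/-- (T-k)-N ⟹ (T-k)-N₂ at one exceptional surface: the binders (D1), (D2) are simply not used. [OURS · pure logic] -/
theorem nodalCurveLiftAt_of_nodalEmbeddedCurveLiftAt (O : Type) [CommRing O] (k : Type) [Field k] (θ : O →+* k) {P : Scheme.{0}}
    (X : Scheme.{0}) (σ : X ⟶ P) (q : P ⟶ Spec (.of O)) (𝓔 : X.IdealSheafData) (h : NodalEmbeddedCurveLiftAt O k θ X σ q 𝓔) :
    NodalCurveLiftAt O k θ X σ q 𝓔 := by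
  intro hXi hXn hXr hEr hEfl hEpr G j t hsq E hE hEtr Z hZ hZE hfin _ _ hEreg hunobs hN4
  exact h hXi hXn hXr hEr hEfl hEpr G j t hsq E hE hEtr Z hZ hZE hfin hEreg hunobs hN4

/-- (T-k)-N ⟹ (T-k)-N₂ for the whole tower. [OURS · pure logic] -/
theorem nodalCurveLift_of_nodalEmbeddedCurveLift (O : Type) [CommRing O] (k : Type) [Field k] (θ : O →+* k) (P : Scheme.{0})
    (q : P ⟶ Spec (.of O)) (h : NodalEmbeddedCurveLift O k θ P q) : NodalCurveLift O k θ P q :=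
  fun X σ 𝓔 => nodalCurveLiftAt_of_nodalEmbeddedCurveLiftAt O k θ X σ q 𝓔 (h X σ 𝓔)

/-- `NodalEmbeddedCurveLiftFact → NodalCurveLiftFact`. [OURS · pure logic] -/
theorem nodalCurveLiftFact_of_nodalEmbeddedCurveLiftFact (h : NodalEmbeddedCurveLiftFact) : NodalCurveLiftFact :=
  fun k _ _ O _ _ _ _ θ hθ P q => nodalCurveLift_of_nodalEmbeddedCurveLift O k θ P q (h k O θ hθ P q)

end Summit.ResolutionOfSingularities.ResolutionOfSingularities.Cruxes.EquisingularLiftNat.Sections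

end
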